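import Summits.QuantumFields.YangMills.Theorems.LuscherReductionTwistedTraceScalingBOTransportEnvelope
import Summits.QuantumFields.YangMills.Theorems.LuscherReductionTwistedTraceScalingBOColourAssembly
import Summits.QuantumFields.YangMills.Theorems.LuscherReductionTwistedTraceScalingBTCoreWeight
import HarnessLib

/-!
# FROM THE CENTRAL QUASIMODE TO THE BORN–OPPENHEIMER STRUCTURE OF THE CORE TRANSFER: the colour integral of the core fibre transfer is
# `c₁·P(x')·K̃₁^{(L³β)}(u',u)/K₁^{(L³β)}(1,1)` up to `e^{±η}(1 ± η_c)` (lane A of S-BASE, crux `TwistedTraceScaling` stmt-QuantumFields-20203, C4-CORE, the (OD) pen;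
# steps (C2)+(C3) ∘ (C1) of `pub/ym-fleet/ym-luscher-20007-p1/COARSE-DESIGN.md` §27.5)

The (B-OD) door in `L²(w)` (`…BODefect`) needs `K̃(φ⊗Ω)(U') ≈ (ψ⊗Ω)(U')·w(U')` on the core of the fat tube.  By `transferApply_boFun_eq` and `…BOColourAssembly.fibreTransfer_fp`,
`Z·K̃(φ⊗Ω)(U') = ∫_u φ(u)·∫_c fpFibreTransfer β Ω W (c⁻¹U'c) u dc du`; the FP weight splits as `W = W_core + W_tail` (`…BTCoreWeight`), and THIS FILE treats the core part:
for a weight `W ≥ 0` supported in the gauge core and a profile `Ω ≥ 0` supported in the fibre core,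
* `fpFibreTransfer_conj_orthoTube` — `fpFibreTransfer (c⁻¹(oT u' v')c) u = fpFibreTransfer (oT (c⁻¹u'c) (R_{c⁻¹}v')) u` (`gaugeTransform_const_orthoTube`);
* `measurable_fpFibreTransfer_conj`, `abs_fpFibreTransfer_le` — integrability of the colour integrand WITHOUT the FP orbit property (the core weight is not an FP weight);
* ★★★ `colour_fpFibreTransfer_two_sided` — THE CORE TRANSFER IS BORN–OPPENHEIMER: if the CENTRAL transfer is a relative `η_c`-quasimode of a colour-blind profile `P ≥ 0` on the
  fibre core, `|fpFibreTransfer β Ω W (oT 1 v'') 1 − c₁·P(v̂'')| ≤ η_c·c₁·P(v̂'')` ((C1), HYPOTHESIS `hC1`), then for every output point `oT u' v'` with `u'` in the `δ`-window and `v'`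
  in the fibre core and every input slow point `u` in the `δu`-window:
  `e^{−η}(1−η_c)·c₁P(v̂')·K̃₁(u',u)/K₁(1,1) ≤ ∫_c fpFibreTransfer β Ω W (c⁻¹(oT u' v')c) u dc ≤ e^{η}(1+η_c)·c₁P(v̂')·K̃₁(u',u)/K₁(1,1)`,
  `η = coreEta L β δ (δ+δu) T R Γ σ + coreEps1 L β δ T R + coreEps2 L β δ T R σ` (`…BOTransportEnvelope`), `K̃₁ = avgKernel ((L:ℝ)^3β)` the gauge(=colour)-averaged ONE-SITE kernel
  (`avgKernel_one_eq_integral_conj`).  No near/far split is needed: every pair (fat window) × (window) is `O(β^{-s})`-close, which costs only the affordable `β·α·T² ≍ β^{-s}ℓ²`.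
So, modulo (C1) and the tails, `K̃(φ⊗Ω)(oT u' v') ≈ (c₁/Z K₁(1,1))·(K̃₁φ)(u')·P(v̂')` with RELATIVE error `e^{η}(1+η_c) − 1` for `φ ≥ 0` (signed `φ = φ⁺ − φ⁻`: defect `≤` that times `(K̃₁|φ|)`),
and with `P = e^{−q}`, `Ω·w = e^{−q}𝟙·N` this is the `L²(w)` quasimode structure the door wants (COARSE-DESIGN §27.3 (a)).
HONEST FRAMING: a reduction; (C1), the tails and (B-ST) are OPEN; C4-CORE OPEN; stub of a child of the CONDITIONAL route R2b1; not infinite volume, not a gap, not Clay.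
-/

set_option autoImplicit false

noncomputable section

open MeasureTheory Filter Topology Real
open scoped BigOperators
open Literature.MathematicalPhysics.QuantumFieldTheory
open Literature.MathematicalPhysics.QuantumLattice

namespace Summit.QuantumFields.YangMills.Theorems.FemtoTransferGap.TwoLattice.ConstTube

open Summit.QuantumFields.YangMills.Theorems.FemtoTransferGap
open Summit.QuantumFields.YangMills.Theorems.FemtoTransferGap.TwoLattice
open Summit.QuantumFields.YangMills.Theorems.FemtoTransferGap.TwoLattice.Avg
open Summit.QuantumFields.YangMills.Theorems.FemtoTransferGap.TwoLattice.Stiff (LinkSpace)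
open Summit.QuantumFields.YangMills.Theorems.FemtoTransferGap.TwoLattice.Cov (sum_sq_adRot_mulVec)
open Summit.QuantumFields.YangMills.Theorems.TwistedTraceScaling.Negative.R33 (gaugeTransform_const_orthoTube)

variable {L : ℕ} [NeZero L]

/-! ## §1 The colour integrand: conjugation of the output point, measurability, boundedness -/

/-- Conjugating the output tube point conjugates its slow datum and rotates its fibre datum:
`fpFibreTransfer (c⁻¹(oT u' v')c) u = fpFibreTransfer (oT (c⁻¹u'c) (R_{c⁻¹}v')) u` (on the cap). [folklore] -/
theorem fpFibreTransfer_conj_orthoTube (β : ℝ) (Ω : LinkSpace L → ℝ) (W : (Site 3 L → SU2) → ℝ) (c : SU2) (u' u : GaugeConfig 3 1 SU2)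
    {v' : Edge 3 L → Fin 3 → ℝ} (hv' : v' ∈ capBalancedSet L) :
    fpFibreTransfer L β Ω W (gaugeTransform (fun _ : Site 3 L => c⁻¹) (orthoTube L u' v')) u =
      fpFibreTransfer L β Ω W (orthoTube L (gaugeTransform (fun _ : Site 3 1 => c⁻¹) u') (colourRotate L (fun _ => c⁻¹) v')) u := by
  rw [gaugeTransform_const_orthoTube c⁻¹ u' (sum_sq_le_one_of_cap L hv'.2)]

/-- `c ↦ fpFibreTransfer β Ω W (c⁻¹Uc) u` is measurable. [folklore] -/
theorem measurable_fpFibreTransfer_conj (β : ℝ) {Ω : LinkSpace L → ℝ} (hΩ : Measurable Ω) {W : (Site 3 L → SU2) → ℝ} (hW : Measurable W) (U : GaugeConfig 3 L SU2)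
    (u : GaugeConfig 3 1 SU2) : Measurable fun c : SU2 => fpFibreTransfer L β Ω W (gaugeTransform (fun _ : Site 3 L => c⁻¹) U) u := by
  haveI : SecondCountableTopology SU2 := secondCountableTopology_su2
  haveI := isFiniteMeasure_orthoTransverse L
  have hK : Measurable fun p : GaugeConfig 3 L SU2 × GaugeConfig 3 L SU2 => transferKernel su2Rep β p.1 p.2 :=
    (continuous_transferKernel su2Rep continuous_su2Rep β).measurable
  -- joint measurability of `(c, (v, g)) ↦ W g · K(c⁻¹Uc, (oT u v)^g) · Ω(v̂)`
  have h1 : Measurable fun q : SU2 × ((Edge 3 L → Fin 3 → ℝ) × (Site 3 L → SU2)) => gaugeTransform (fun _ : Site 3 L => q.1⁻¹) U := by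
    have hc : Measurable fun _ : SU2 × ((Edge 3 L → Fin 3 → ℝ) × (Site 3 L → SU2)) => U := measurable_const
    have ha : Measurable fun q : SU2 × ((Edge 3 L → Fin 3 → ℝ) × (Site 3 L → SU2)) => (U, q.1⁻¹) := hc.prodMk measurable_fst.inv
    have h := (measurable_constGaugeAction (L := L)).comp ha
    simpa only [Function.comp_def] using h
  have h2 : Measurable fun q : SU2 × ((Edge 3 L → Fin 3 → ℝ) × (Site 3 L → SU2)) => gaugeTransform q.2.2 (orthoTube L u q.2.1) := by
    have ha : Measurable fun q : SU2 × ((Edge 3 L → Fin 3 → ℝ) × (Site 3 L → SU2)) => (orthoTube L u q.2.1, q.2.2) :=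
      ((measurable_orthoTube_right (L := L) u).comp (measurable_fst.comp measurable_snd)).prodMk (measurable_snd.comp measurable_snd)
    have h := (measurable_gaugeAction (L := L)).comp ha
    simpa only [Function.comp_def] using h
  have h3 : Measurable fun q : SU2 × ((Edge 3 L → Fin 3 → ℝ) × (Site 3 L → SU2)) =>
      transferKernel su2Rep β (gaugeTransform (fun _ : Site 3 L => q.1⁻¹) U) (gaugeTransform q.2.2 (orthoTube L u q.2.1)) := by
    have h := hK.comp (h1.prodMk h2); simpa only [Function.comp_def] using h
  have hF : Measurable fun q : SU2 × ((Edge 3 L → Fin 3 → ℝ) × (Site 3 L → SU2)) =>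
      W q.2.2 * transferKernel su2Rep β (gaugeTransform (fun _ : Site 3 L => q.1⁻¹) U) (gaugeTransform q.2.2 (orthoTube L u q.2.1)) * Ω (linkEmbed L q.2.1) :=
    ((hW.comp (measurable_snd.comp measurable_snd)).mul h3).mul (hΩ.comp ((measurable_linkEmbed L).comp (measurable_fst.comp measurable_snd)))
  have hI := (hF.stronglyMeasurable.integral_prod_right' (ν := (orthoTransverse L).prod (gaugeMeasure L))).measurable
  unfold fpFibreTransfer
  simpa only using hI

/-- `|fpFibreTransfer β Ω W U u| ≤ B·(π⊗dg)(V × G)` with the bound `B` of the integrand. [folklore] -/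
theorem abs_fpFibreTransfer_le (β : ℝ) {Ω : LinkSpace L → ℝ} {CΩ : ℝ} (hCΩ : ∀ x, |Ω x| ≤ CΩ) {W : (Site 3 L → SU2) → ℝ} {CW : ℝ} (hCW : ∀ g, |W g| ≤ CW)
    (u : GaugeConfig 3 1 SU2) : ∃ B : ℝ, ∀ U : GaugeConfig 3 L SU2, |fpFibreTransfer L β Ω W U u| ≤ B := by
  haveI := isFiniteMeasure_orthoTransverse L
  obtain ⟨M, hM⟩ := exists_transferKernel_le su2Rep continuous_su2Rep β (L := L)
  have hCW0 : 0 ≤ CW := (abs_nonneg _).trans (hCW 1)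
  have hM0 : 0 ≤ M := (transferKernel_pos su2Rep β (1 : GaugeConfig 3 L SU2) 1).le.trans (hM 1 1)
  refine ⟨CW * M * CΩ * ((orthoTransverse L).prod (gaugeMeasure L)).real Set.univ, fun U => ?_⟩
  have hb : ∀ p : (Edge 3 L → Fin 3 → ℝ) × (Site 3 L → SU2), |W p.2 * transferKernel su2Rep β U (gaugeTransform p.2 (orthoTube L u p.1)) * Ω (linkEmbed L p.1)| ≤ CW * M * CΩ :=
    fun p => by
      rw [abs_mul, abs_mul, abs_of_pos (transferKernel_pos su2Rep β _ _)]
      exact mul_le_mul (mul_le_mul (hCW _) (hM _ _) (transferKernel_pos su2Rep β _ _).le hCW0) (hCΩ _) (abs_nonneg _) (mul_nonneg hCW0 hM0)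
  unfold fpFibreTransfer
  calc |∫ p, W p.2 * transferKernel su2Rep β U (gaugeTransform p.2 (orthoTube L u p.1)) * Ω (linkEmbed L p.1) ∂(orthoTransverse L).prod (gaugeMeasure L)|
      ≤ ∫ p, |W p.2 * transferKernel su2Rep β U (gaugeTransform p.2 (orthoTube L u p.1)) * Ω (linkEmbed L p.1)| ∂(orthoTransverse L).prod (gaugeMeasure L) :=
        abs_integral_le_integral_abs
    _ ≤ ∫ _p, CW * M * CΩ ∂(orthoTransverse L).prod (gaugeMeasure L) :=
        integral_mono_of_nonneg (ae_of_all _ fun _ => abs_nonneg _) (integrable_const _) (ae_of_all _ hb)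
    _ = CW * M * CΩ * ((orthoTransverse L).prod (gaugeMeasure L)).real Set.univ := by rw [integral_const, smul_eq_mul, Measure.real]; ring

/-! ## §2 Small facts about conjugated slow data and rotated fibre data -/

/-- Conjugation does not move the distance of a one-site link to `1`. [folklore] -/
theorem norm_su2Quat_conj_sub_one (c g : SU2) : ‖su2Quat (c * g * c⁻¹) - 1‖ = ‖su2Quat g - 1‖ := by
  have h := norm_su2Quat_conj_sub_conj c g 1
  rwa [show c * 1 * c⁻¹ = 1 by group, su2Quat_one] at h

omit [NeZero L] in
/-- A rotated fibre datum with per-link Euclidean size `≤ T` has components `≤ T`. [folklore] -/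
theorem abs_colourRotate_apply_le {v : Edge 3 L → Fin 3 → ℝ} {T : ℝ} (hT : 0 ≤ T) (hv : ∀ e : Edge 3 L, ∑ a, v e a ^ 2 ≤ T ^ 2) (r : Fin 3 → SU2) (e : Edge 3 L)
    (a : Fin 3) : |colourRotate L r v e a| ≤ T := by
  have h1 : (colourRotate L r v e a) ^ 2 ≤ ∑ b, (colourRotate L r v e b) ^ 2 :=
    Finset.single_le_sum (f := fun b => (colourRotate L r v e b) ^ 2) (fun b _ => sq_nonneg _) (Finset.mem_univ a)
  have h2 : ∑ b, (colourRotate L r v e b) ^ 2 = ∑ b, v e b ^ 2 := by unfold colourRotate; exact sum_sq_adRot_mulVec (r e.2) (v e)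
  have h3 : (colourRotate L r v e a) ^ 2 ≤ T ^ 2 := by rw [h2] at h1; exact h1.trans (hv e)
  exact abs_le_of_sq_le_sq' h3 hT |>.elim (fun h h' => abs_le.mpr ⟨h, h'⟩)

/-! ## §3 ★★★ The colour integral of the core transfer is Born–Oppenheimer, given the central quasimode -/

/-- ★★★ **CORE TRANSFER FROM THE CENTRAL QUASIMODE.**  See the module docstring.  Hypotheses: `β ≥ 0`; `Ω ≥ 0` bounded measurable, supported in the fibre core
(`v ∈ cap`, `|v_{e,a}| ≤ T`, `‖v̂‖ ≤ R`); `W ≥ 0` bounded measurable, supported in the gauge core (`‖g_x − 1‖ ≤ T`, `‖Σ g⃗_x‖ ≤ Γ`); `T ≤ 1/30`; the output point: `u'` with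
`‖u'_k − 1‖ ≤ δ`, `L³S₁(u') ≤ σ`, `v' ∈ cap` with per-link size `Σ_a v'_{e,a}² ≤ T²` and `‖v̂'‖ ≤ R`; the input slow point: `‖u_k − 1‖ ≤ δu`, `L³S₁(u) ≤ σ`; `δ ≤ 1/2`, `δ + δu ≤ 1`,
`σ < 2`; a colour-blind `P` (no sign needed: the sandwich comes from `hC1`); and (C1) `hC1`. [cite: Luscher1983, §3] -/
theorem colour_fpFibreTransfer_two_sided {β : ℝ} (hβ : 0 ≤ β) {Ω : LinkSpace L → ℝ} (hΩm : Measurable Ω) {CΩ : ℝ} (hCΩ : ∀ x, |Ω x| ≤ CΩ) (hΩ0 : ∀ x, 0 ≤ Ω x)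
    {W : (Site 3 L → SU2) → ℝ} (hW : Measurable W) {CW : ℝ} (hCW : ∀ g, |W g| ≤ CW) (hW0 : ∀ g, 0 ≤ W g)
    {δ δu T R Γ σ : ℝ} (hδ1 : δ ≤ 1 / 2) (hα1 : δ + δu ≤ 1) (hT0 : 0 ≤ T) (hT : T ≤ 1 / 30) (hσ : σ < 2)
    (hΩt : ∀ v : Edge 3 L → Fin 3 → ℝ, Ω (linkEmbed L v) ≠ 0 → v ∈ capBalancedSet L ∧ (∀ (e : Edge 3 L) (c : Fin 3), |v e c| ≤ T) ∧ ‖linkEmbed L v‖ ≤ R)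
    (hWc : ∀ g : Site 3 L → SU2, W g ≠ 0 → (∀ x, ‖su2Quat (g x) - 1‖ ≤ T) ∧ ‖∑ x, vecPart (g x)‖ ≤ Γ)
    {P : LinkSpace L → ℝ} (hPinv : ∀ (g : SU2) (x : LinkSpace L), P (adL L g x) = P x) {c₁ ηc : ℝ}
    (hC1 : ∀ v'' : Edge 3 L → Fin 3 → ℝ, v'' ∈ capBalancedSet L → (∀ (e : Edge 3 L) (a : Fin 3), |v'' e a| ≤ T) → ‖linkEmbed L v''‖ ≤ R →
      |fpFibreTransfer L β Ω W (orthoTube L 1 v'') 1 - c₁ * P (linkEmbed L v'')| ≤ ηc * (c₁ * P (linkEmbed L v'')))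
    (u' u : GaugeConfig 3 1 SU2) (hu' : ∀ k : Fin 3, ‖su2Quat (u' (0, k)) - 1‖ ≤ δ) (hS' : (L : ℝ) ^ 3 * wilsonAction su2Rep u' ≤ σ)
    (hu : ∀ k : Fin 3, ‖su2Quat (u (0, k)) - 1‖ ≤ δu) (hS : (L : ℝ) ^ 3 * wilsonAction su2Rep u ≤ σ)
    {v' : Edge 3 L → Fin 3 → ℝ} (hv' : v' ∈ capBalancedSet L) (hv'T : ∀ e : Edge 3 L, ∑ a, v' e a ^ 2 ≤ T ^ 2) (hx' : ‖linkEmbed L v'‖ ≤ R) :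
    Real.exp (-(coreEta L β δ (δ + δu) T R Γ σ + coreEps1 L β δ T R + coreEps2 L β δ T R σ)) * (1 - ηc) *
        (c₁ * P (linkEmbed L v') * (avgKernel ((L : ℝ) ^ 3 * β) u' u / transferKernel su2Rep ((L : ℝ) ^ 3 * β) (1 : GaugeConfig 3 1 SU2) 1)) ≤
        ∫ c, fpFibreTransfer L β Ω W (gaugeTransform (fun _ : Site 3 L => c⁻¹) (orthoTube L u' v')) u ∂haarProbability SU2 ∧
      ∫ c, fpFibreTransfer L β Ω W (gaugeTransform (fun _ : Site 3 L => c⁻¹) (orthoTube L u' v')) u ∂haarProbability SU2 ≤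
        Real.exp (coreEta L β δ (δ + δu) T R Γ σ + coreEps1 L β δ T R + coreEps2 L β δ T R σ) * (1 + ηc) *
          (c₁ * P (linkEmbed L v') * (avgKernel ((L : ℝ) ^ 3 * β) u' u / transferKernel su2Rep ((L : ℝ) ^ 3 * β) (1 : GaugeConfig 3 1 SU2) 1)) := by
  haveI : SecondCountableTopology SU2 := secondCountableTopology_su2
  set B : ℝ := (L : ℝ) ^ 3 * β with hB
  set η : ℝ := coreEta L β δ (δ + δu) T R Γ σ + coreEps1 L β δ T R + coreEps2 L β δ T R σ with hη
  have hK1 : 0 < transferKernel su2Rep B (1 : GaugeConfig 3 1 SU2) 1 := transferKernel_pos _ _ _ _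
  -- the slow ratio `ρ(c) = K₁(c⁻¹u'c, u)/K₁(1,1)`: measurable, bounded, integrates to `K̃₁(u',u)/K₁(1,1)`
  set ρ : SU2 → ℝ := fun c => transferKernel su2Rep B (gaugeTransform (fun _ : Site 3 1 => c⁻¹) u') u / transferKernel su2Rep B (1 : GaugeConfig 3 1 SU2) 1 with hρ
  obtain ⟨M1, hM1⟩ := exists_transferKernel_le su2Rep continuous_su2Rep B (L := 1)
  have hρm : Measurable ρ := by
    have hK : Measurable fun p : GaugeConfig 3 1 SU2 × GaugeConfig 3 1 SU2 => transferKernel su2Rep B p.1 p.2 :=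
      (continuous_transferKernel su2Rep continuous_su2Rep B).measurable
    have hc : Measurable fun c : SU2 => gaugeTransform (fun _ : Site 3 1 => c⁻¹) u' := by
      have hcu : Measurable fun _ : SU2 => u' := measurable_const
      have h := (measurable_constGaugeAction (L := 1)).comp (hcu.prodMk measurable_inv)
      simpa only [Function.comp_def] using h
    have hu0 : Measurable fun _ : SU2 => u := measurable_const
    have h := hK.comp (hc.prodMk hu0)
    exact (by simpa only [Function.comp_def] using h : Measurable fun c : SU2 => transferKernel su2Rep B (gaugeTransform (fun _ : Site 3 1 => c⁻¹) u') u).div_const _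
  have hρ0 : ∀ c, 0 ≤ ρ c := fun c => div_nonneg (transferKernel_pos _ _ _ _).le hK1.le
  have hρb : ∀ c, |ρ c| ≤ M1 / transferKernel su2Rep B (1 : GaugeConfig 3 1 SU2) 1 := fun c => by
    rw [abs_of_nonneg (hρ0 c)]; exact div_le_div_of_nonneg_right (hM1 _ _) hK1.le
  have hρint : Integrable ρ (haarProbability SU2) := integrable_of_measurable_abs_le _ hρm hρb
  have hρI : ∫ c, ρ c ∂haarProbability SU2 = avgKernel B u' u / transferKernel su2Rep B (1 : GaugeConfig 3 1 SU2) 1 := by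
    rw [hρ, integral_div, ← avgKernel_one_eq_integral_conj]
  -- the colour integrand: measurable, bounded, and pointwise sandwiched
  set F : SU2 → ℝ := fun c => fpFibreTransfer L β Ω W (gaugeTransform (fun _ : Site 3 L => c⁻¹) (orthoTube L u' v')) u with hF
  have hFm : Measurable F := measurable_fpFibreTransfer_conj β hΩm hW _ u
  obtain ⟨BF, hBF⟩ := abs_fpFibreTransfer_le (L := L) β hCΩ hCW u
  have hFint : Integrable F (haarProbability SU2) := integrable_of_measurable_abs_le _ hFm fun c => hBF _
  have hpt : ∀ c : SU2, Real.exp (-η) * (1 - ηc) * (c₁ * P (linkEmbed L v')) * ρ c ≤ F c ∧ F c ≤ Real.exp η * (1 + ηc) * (c₁ * P (linkEmbed L v')) * ρ c := by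
    intro c
    -- the conjugated output point
    set u'' : GaugeConfig 3 1 SU2 := gaugeTransform (fun _ : Site 3 1 => c⁻¹) u' with hu''
    set v'' : Edge 3 L → Fin 3 → ℝ := colourRotate L (fun _ => c⁻¹) v' with hv''
    have hFc : F c = fpFibreTransfer L β Ω W (orthoTube L u'' v'') u := by rw [hF]; exact fpFibreTransfer_conj_orthoTube β Ω W c u' u hv'
    -- hypotheses of the transport at the conjugated point
    have hu''δ : ∀ k : Fin 3, ‖su2Quat (u'' (0, k)) - 1‖ ≤ δ := fun k => by
      rw [hu'']
      show ‖su2Quat (c⁻¹ * u' (0, k) * c⁻¹⁻¹) - 1‖ ≤ δ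
      rw [norm_su2Quat_conj_sub_one]; exact hu' k
    have hα : ∀ k : Fin 3, ‖su2Quat (u'' (0, k)) - su2Quat (u (0, k))‖ ≤ δ + δu := fun k => by
      calc ‖su2Quat (u'' (0, k)) - su2Quat (u (0, k))‖ = ‖(su2Quat (u'' (0, k)) - 1) + (1 - su2Quat (u (0, k)))‖ := by congr 1; abel
        _ ≤ ‖su2Quat (u'' (0, k)) - 1‖ + ‖1 - su2Quat (u (0, k))‖ := norm_add_le _ _
        _ ≤ δ + δu := add_le_add (hu''δ k) (by rw [norm_sub_rev]; exact hu k)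
    have hS'' : (L : ℝ) ^ 3 * wilsonAction su2Rep u'' ≤ σ := by rw [hu'', wilsonAction_gaugeTransform]; exact hS'
    have hv''cap : v'' ∈ capBalancedSet L := colourRotate_mem_capBalancedSet L hv'
    have hv''T : ∀ (e : Edge 3 L) (a : Fin 3), |v'' e a| ≤ T := fun e a => abs_colourRotate_apply_le hT0 hv'T _ e a
    have hx'' : linkEmbed L v'' = adL L c⁻¹ (linkEmbed L v') := by rw [hv'']; exact linkEmbed_colourRotate_const c⁻¹ v'
    have hx''R : ‖linkEmbed L v''‖ ≤ R := by rw [hx'', LinearIsometryEquiv.norm_map]; exact hx'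
    have hPx : P (linkEmbed L v'') = P (linkEmbed L v') := by rw [hx'', hPinv]
    -- transport to the central fibre and the central quasimode
    have htr := fpFibreTransfer_two_sided_core hβ hΩm hCΩ hΩ0 hW hCW hW0 u'' u hv''cap hu''δ hδ1 hα hα1 hT hσ hS'' hS hv''T hx''R hΩt hWc
    have hq := abs_le.mp (hC1 v'' hv''cap hv''T hx''R)
    rw [hPx] at hq
    have hρc : transferKernel su2Rep ((L : ℝ) ^ 3 * β) u'' u / transferKernel su2Rep ((L : ℝ) ^ 3 * β) (1 : GaugeConfig 3 1 SU2) 1 = ρ c := by rw [hρ, hB]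
    rw [hρc, ← hη] at htr
    have hT1lo : (1 - ηc) * (c₁ * P (linkEmbed L v')) ≤ fpFibreTransfer L β Ω W (orthoTube L 1 v'') 1 := by linarith [hq.1]
    have hT1hi : fpFibreTransfer L β Ω W (orthoTube L 1 v'') 1 ≤ (1 + ηc) * (c₁ * P (linkEmbed L v')) := by linarith [hq.2]
    have he0 : 0 ≤ Real.exp (-η) * ρ c := mul_nonneg (Real.exp_pos _).le (hρ0 c)
    have he1 : 0 ≤ Real.exp η * ρ c := mul_nonneg (Real.exp_pos _).le (hρ0 c)
    rw [hFc]
    constructor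
    · calc Real.exp (-η) * (1 - ηc) * (c₁ * P (linkEmbed L v')) * ρ c = Real.exp (-η) * ρ c * ((1 - ηc) * (c₁ * P (linkEmbed L v'))) := by ring
        _ ≤ Real.exp (-η) * ρ c * fpFibreTransfer L β Ω W (orthoTube L 1 v'') 1 := mul_le_mul_of_nonneg_left hT1lo he0
        _ ≤ fpFibreTransfer L β Ω W (orthoTube L u'' v'') u := htr.1
    · calc fpFibreTransfer L β Ω W (orthoTube L u'' v'') u ≤ Real.exp η * ρ c * fpFibreTransfer L β Ω W (orthoTube L 1 v'') 1 := htr.2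
        _ ≤ Real.exp η * ρ c * ((1 + ηc) * (c₁ * P (linkEmbed L v'))) := mul_le_mul_of_nonneg_left hT1hi he1
        _ = Real.exp η * (1 + ηc) * (c₁ * P (linkEmbed L v')) * ρ c := by ring
  -- integrate over the colour
  have hFdef : ∫ c, fpFibreTransfer L β Ω W (gaugeTransform (fun _ : Site 3 L => c⁻¹) (orthoTube L u' v')) u ∂haarProbability SU2 = ∫ c, F c ∂haarProbability SU2 := rfl
  rw [hFdef]
  constructor
  · calc Real.exp (-η) * (1 - ηc) * (c₁ * P (linkEmbed L v') * (avgKernel B u' u / transferKernel su2Rep B (1 : GaugeConfig 3 1 SU2) 1))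
        = ∫ c, Real.exp (-η) * (1 - ηc) * (c₁ * P (linkEmbed L v')) * ρ c ∂haarProbability SU2 := by rw [integral_const_mul, hρI]; ring
      _ ≤ ∫ c, F c ∂haarProbability SU2 := integral_mono (hρint.const_mul _) hFint fun c => (hpt c).1
  · calc ∫ c, F c ∂haarProbability SU2 ≤ ∫ c, Real.exp η * (1 + ηc) * (c₁ * P (linkEmbed L v')) * ρ c ∂haarProbability SU2 :=
          integral_mono hFint (hρint.const_mul _) fun c => (hpt c).2
      _ = Real.exp η * (1 + ηc) * (c₁ * P (linkEmbed L v') * (avgKernel B u' u / transferKernel su2Rep B (1 : GaugeConfig 3 1 SU2) 1)) := by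
          rw [integral_const_mul, hρI]; ring

end Summit.QuantumFields.YangMills.Theorems.FemtoTransferGap.TwoLattice.ConstTube

end
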